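import Literature.Geometry.Kaehler.HolomorphicChainBlowUpBounded
import Literature.Geometry.Kaehler.HolomorphicChainRectifiableHolds
import Literature.Geometry.Kaehler.LelongTheorem

/-!
# Uniform upper bounds for the mass of a holomorphic chain in small balls

For a holomorphic `p`-chain `T` on `Ω ⊆ V`, a base point `b` and `0 < R₁` with `B(b, 3R₁) ⊆ Ω`,
there is a constant `C < ∞` with
**`∫_{reg|T| ∩ B(a, t)} |θ_T| d𝓗^{2p} ≤ C · t^{2p}`** for every centre `a ∈ 𝐁(b, R₁)` and every
radius `0 < t ≤ R₁` (`HolomorphicChain.exists_lintegral_density_ball_le`): by local finiteness only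
finitely many components `A_Z` meet `𝐁(b, 2R₁)`, on each the mass ratio
`𝓗^{2p}(A_Z ∩ B(a,t))/t^{2p}` is monotone in `t < R₁` ([Chirka1989, §15.1 Prop. 1], the named fact
`Chirka1989_massRatio_monotoneOn`, taken as a hypothesis), and `𝓗^{2p}(A_Z ∩ B(b, 2R₁)) < ∞`
(Lelong, discharged). These are the uniform density bounds ("(UDB)") controlling the blow-ups of
`[T]` near small exceptional sets in King's tangent cone theorem.

Theorems only; no named facts (one named fact enters as a hypothesis).

## References

* E. M. Chirka, *Complex Analytic Sets*, Kluwer 1989, §15.1 Prop. 1, §16.1 [Chirka1989].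
* R. Harvey, *Holomorphic chains and their boundaries*, PSPUM XXX.1 (1977), §1.10 [Harvey1977].
-/

noncomputable section

open scoped Manifold Topology ENNReal
open Set Filter Metric Function TopologicalSpace MeasureTheory

namespace Literature.Geometry.Kaehler

namespace HolomorphicChain

universe u

variable {V : Type u} [NormedAddCommGroup V] [InnerProductSpace ℂ V] [FiniteDimensional ℂ V]
  [MeasurableSpace V] [BorelSpace V] {Ω : Opens V} {p : ℕ}

/-- **Uniform upper density bounds for a holomorphic chain**: with `B(b, 3R₁) ⊆ Ω`, `0 < R₁`,
there is `C < ∞` such that `∫_{reg|T| ∩ B(a,t)} |θ_T| d𝓗^{2p} ≤ C t^{2p}` for all `a ∈ 𝐁(b, R₁)`,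
`0 < t ≤ R₁` (monotonicity of the mass ratios of the finitely many components meeting `𝐁(b,2R₁)`,
and Lelong's theorem). [cite: Chirka1989, §15.1 Prop. 1, §16.1; Harvey1977, §1.10] -/
theorem exists_lintegral_density_ball_le (hmono : Chirka1989_massRatio_monotoneOn.{u})
    (T : HolomorphicChain 𝓘(ℂ, V) Ω p) {b : V} {R₁ : ℝ} (hR₁ : 0 < R₁)
    (hball : ball b (3 * R₁) ⊆ (Ω : Set V)) :
    ∃ C : ℝ≥0∞, C ≠ ⊤ ∧ ∀ a ∈ closedBall b R₁, ∀ t : ℝ, 0 < t → t ≤ R₁ →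
      ∫⁻ x in T.carrier ∩ ball a t, ‖(T.density x : ℝ)‖ₑ ∂(μHE[2 * p] : Measure V) ≤
        C * ENNReal.ofReal (t ^ (2 * p)) := by
  classical
  letI : InnerProductSpace ℝ V := InnerProductSpace.complexToReal
  have hT := Harvey1977_isRectifiableData_toCurrent_holds V Ω p T
  -- the finitely many components meeting `𝐁(b, 2R₁)`
  have hK : closedBall b (2 * R₁) ⊆ (Ω : Set V) :=
    (closedBall_subset_ball (by linarith)).trans hball
  have hKc := isCompact_preimage_coe_closedBall (Ω := Ω) hK
  set F := (T.finite_inter_compact hKc).toFinset with hFdef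
  have hFmem : ∀ Z, Z ∈ F ↔ T.mult Z ≠ 0 ∧ (((↑) ⁻¹' closedBall b (2 * R₁) : Set Ω) ∩ Z).Nonempty :=
    fun Z => Set.Finite.mem_toFinset _
  -- the constants `c_Z = 𝓗(A_Z ∩ B(b, 2R₁)) / R₁^{2p}`
  set c : Set Ω → ℝ≥0∞ := fun Z =>
    (μHE[2 * p] : Measure V) (((↑) '' Z : Set V) ∩ ball b (2 * R₁)) / ENNReal.ofReal (R₁ ^ (2 * p))
    with hc
  refine ⟨∑ Z ∈ F, ENNReal.ofReal |(T.mult Z : ℝ)| * c Z, ?_, fun a ha t ht htR => ?_⟩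
  · rw [ENNReal.sum_ne_top]
    intro Z hZ
    have hpure := T.hasPureDim_of_mult_ne_zero ((hFmem Z).1 hZ).1
    have hfin := Lelong1957_hausdorffMeasure_inter_lt_top_holds V Ω p Z hpure _
      (isCompact_closedBall b (2 * R₁)) hK
    refine ENNReal.mul_ne_top ENNReal.ofReal_ne_top (ENNReal.div_lt_top ?_ ?_).ne
    · exact ne_top_of_le_ne_top hfin.ne (measure_mono (inter_subset_inter_right _ ball_subset_closedBall))
    · exact (ENNReal.ofReal_pos.2 (pow_pos hR₁ _)).ne'
  · -- components meeting `𝐁(a, R₁) ⊆ 𝐁(b, 2R₁)` belong to `F`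
    rw [mem_closedBall] at ha
    have haR : closedBall a R₁ ⊆ closedBall b (2 * R₁) := fun x hx => by
      rw [mem_closedBall] at hx ⊢
      linarith [dist_triangle x a b]
    have hF : ∀ Z : Set Ω, T.mult Z ≠ 0 → (((↑) '' Z : Set V) ∩ closedBall a R₁).Nonempty → Z ∈ F := by
      rintro Z hZ ⟨_, ⟨x', hx', rfl⟩, hxK⟩
      exact (hFmem Z).2 ⟨hZ, ⟨x', haR hxK, hx'⟩⟩
    have h1 := T.lintegral_enorm_density_le hT.1 htR F hF
    -- monotonicity at the centre `a` (with `B(a, R₁ + R₁) ⊆ Ω`… we use `B(a, 2R₁) ⊆ B(b, 3R₁)`)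
    have haball : ball a (2 * R₁) ⊆ (Ω : Set V) := fun x hx => hball (by
      rw [mem_ball] at hx ⊢; linarith [dist_triangle x a b])
    have h2 : ∀ Z ∈ F, (μHE[2 * p] : Measure V) (((↑) '' Z : Set V) ∩ ball a t) ≤
        ENNReal.ofReal (t ^ (2 * p)) * c Z := by
      intro Z hZ
      have hpure := T.hasPureDim_of_mult_ne_zero ((hFmem Z).1 hZ).1
      have hm := hmono V Ω p Z hpure a (2 * R₁) haball
      -- compare radius `t` with radius `R₁' := R₁` hmm: we need a radius `< 2R₁`; use `R₁`… but then
      -- `𝓗(A_Z ∩ B(a, R₁)) ≤ 𝓗(A_Z ∩ B(b, 2R₁))`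
      have hle := hm ⟨ht, by linarith⟩ ⟨hR₁, by linarith⟩ htR
      have ht0 : ENNReal.ofReal (t ^ (2 * p)) ≠ 0 := (ENNReal.ofReal_pos.2 (pow_pos ht _)).ne'
      have hsub : ((↑) '' Z : Set V) ∩ ball a R₁ ⊆ ((↑) '' Z : Set V) ∩ ball b (2 * R₁) :=
        inter_subset_inter_right _ fun x hx => by
          rw [mem_ball] at hx ⊢; linarith [dist_triangle x a b]
      calc (μHE[2 * p] : Measure V) (((↑) '' Z : Set V) ∩ ball a t)
          = (μHE[2 * p] : Measure V) (((↑) '' Z : Set V) ∩ ball a t) /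
              ENNReal.ofReal (t ^ (2 * p)) * ENNReal.ofReal (t ^ (2 * p)) :=
            (ENNReal.div_mul_cancel ht0 ENNReal.ofReal_ne_top).symm
        _ ≤ (μHE[2 * p] : Measure V) (((↑) '' Z : Set V) ∩ ball a R₁) /
              ENNReal.ofReal (R₁ ^ (2 * p)) * ENNReal.ofReal (t ^ (2 * p)) := by gcongr
        _ ≤ c Z * ENNReal.ofReal (t ^ (2 * p)) := by
            gcongr
            exact ENNReal.div_le_div_right (measure_mono hsub) _
        _ = ENNReal.ofReal (t ^ (2 * p)) * c Z := mul_comm _ _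
    calc ∫⁻ x in T.carrier ∩ ball a t, ‖(T.density x : ℝ)‖ₑ ∂(μHE[2 * p] : Measure V)
        ≤ ∑ Z ∈ F, ENNReal.ofReal |(T.mult Z : ℝ)| *
            (μHE[2 * p] : Measure V) (((↑) '' Z : Set V) ∩ ball a t) := h1
      _ ≤ ∑ Z ∈ F, ENNReal.ofReal |(T.mult Z : ℝ)| * (ENNReal.ofReal (t ^ (2 * p)) * c Z) := by
          gcongr with Z hZ
          exact h2 Z hZ
      _ = (∑ Z ∈ F, ENNReal.ofReal |(T.mult Z : ℝ)| * c Z) * ENNReal.ofReal (t ^ (2 * p)) := by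
          rw [Finset.sum_mul]
          refine Finset.sum_congr rfl fun Z _ => ?_
          ring

end HolomorphicChain

end Literature.Geometry.Kaehler
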